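import Summits.AtomisticToContinuum.Crystallization.Theorems.PricedLinkCensusTruncatedCensusGapStrainedMarginCertAnalysis

/-!
# Strained-margin certificate — soundness of the box checker (part 2)

Route `PricedLinkCensus`, crux `TruncatedCensusGap` (stmt-AtomisticToContinuum-14230), line
`near-far-split`, stub `stub_strainedMarginCert` (N1b).  Soundness of the rational box checker of
`…StrainedMarginCertDefs`: the line minorant of a class on a `w`-range lies below `g`
(`lineLB_sound`: tangent of the convex `L`, secant of the concave minorant `χ̄ · L`, monotone
and floor fallbacks), the summed lines are bilinear in `(u, t)` and controlled by their corner
values, `famOK`/`boxOK`/`check` are sound, and `certificate = true` yields the threshold bound on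
both strained strips (`certificate_sound`).  All `[folklore]`.
-/

noncomputable section

namespace Summit.AtomisticToContinuum.Crystallization.Theorems.PricedLinkCensusTruncatedCensusGap.StrainedMargin

/-! ## Soundness of the line minorant (part Line) -/

section Line
open Real Set

/-- A cube bound: `w³ ≤ 7/4 → w ≤ 9/4`. [folklore] -/
theorem le_of_cube_le {w : ℝ} (h : w ^ 3 ≤ 7 / 4) : w ≤ 9 / 4 := by
  refine le_of_not_gt fun hlt => ?_
  have : (9 / 4 : ℝ) ^ 3 < w ^ 3 := by gcongr
  linarith

/-- A cube bound: `7/4 ≤ w³ → 1 ≤ w`. [folklore] -/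
theorem one_le_of_le_cube {w : ℝ} (h : 7 / 4 ≤ w ^ 3) : 1 ≤ w := by
  refine le_of_not_gt fun hlt => ?_
  rcases le_or_gt 0 w with h0 | h0
  · have : w ^ 3 < 1 ^ 3 := by gcongr
    linarith
  · have : w ^ 3 < 0 := by
      rw [show w ^ 3 = w * (w * w) by ring]
      exact mul_neg_of_neg_of_pos h0 (mul_pos_of_neg_of_neg h0 h0)
    linarith

/-- **Soundness of `lineLB`**: on the range `[w₁, w₂]` the produced line is below `g`. [folklore] -/
theorem lineLB_sound {w₁ w₂ : ℚ} (h0 : 0 < w₁) (h12 : w₁ ≤ w₂) {w : ℝ} (hw1 : (w₁ : ℝ) ≤ w)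
    (hw2 : w ≤ w₂) : (((lineLB w₁ w₂).1 : ℚ) : ℝ) * w + (((lineLB w₁ w₂).2 : ℚ) : ℝ) ≤ gR w := by
  have h0R : (0 : ℝ) < w₁ := by exact_mod_cast h0
  have hw0 : 0 < w := lt_of_lt_of_le h0R hw1
  have h12R : (w₁ : ℝ) ≤ w₂ := by exact_mod_cast h12
  unfold lineLB
  split_ifs with hA hB hC hD hE
  · -- `cvx`: tangent of the convex `L` at the midpoint
    have hA' : (w₂ : ℝ) ^ 3 ≤ 7 / 4 := by have := castLE hA; push_cast at this; exact this
    have hconv := convexOn_LR (w₁ := (w₁ : ℝ)) (w₂ := (w₂ : ℝ)) h0R hA'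
    have hw94 : w ≤ 9 / 4 := hw2.trans (le_of_cube_le hA')
    rw [gR_eq_LR hw0 hw94]
    push_cast
    rw [cast_Lpq, cast_Lq]
    push_cast
    set m : ℝ := ((w₁ : ℝ) + w₂) / 2 with hm
    have hmS : m ∈ Icc (w₁ : ℝ) w₂ := ⟨by rw [hm]; linarith, by rw [hm]; linarith⟩
    have hwS : w ∈ Icc (w₁ : ℝ) w₂ := ⟨hw1, hw2⟩
    have hm0 : m ≠ 0 := by rw [hm]; linarith
    have hder := hasDerivAt_LR hm0
    rcases lt_trichotomy w m with hlt | heq | hgt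
    · have := hconv.slope_le_of_hasDerivAt hwS hmS hlt hder
      rw [slope_def_field] at this
      rw [div_le_iff₀ (by linarith)] at this
      linarith
    · rw [heq]; linarith
    · have := hconv.le_slope_of_hasDerivAt hmS hwS hgt hder
      rw [slope_def_field] at this
      rw [le_div_iff₀ (by linarith)] at this
      linarith
  · -- `ccv`, degenerate range
    have hw' : w = w₁ := le_antisymm (by rw [hC] at hw1 ⊢; exact_mod_cast hw2) hw1
    push_cast
    rw [zero_mul, zero_add, cast_Lq, hw']
    exact chiHi_mul_LR_le_gR h0
  · -- `ccv`: secant of the concave minorant `χ̄ · L`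
    have h74 : (7 / 4 : ℝ) ≤ (w₁ : ℝ) ^ 3 := by have := castLE hB.1; push_cast at this; exact this
    have h1 : (1 : ℝ) ≤ w₁ := one_le_of_le_cube h74
    have hne : (w₂ : ℝ) - w₁ ≠ 0 := by
      intro h0; exact hC (by exact_mod_cast (show (w₁ : ℝ) = w₂ by linarith))
    have hne' : -(w₁ : ℝ) + w₂ ≠ 0 := by rw [neg_add_eq_sub]; exact hne
    have hlt : (w₁ : ℝ) < w₂ := lt_of_le_of_ne h12R (by exact_mod_cast hC)
    set c₁ : ℝ := ((chiHi w₁ : ℚ) : ℝ) with hc₁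
    set c₂ : ℝ := ((chiHi w₂ : ℚ) : ℝ) with hc₂
    have hc₁0 : 0 ≤ c₁ := by rw [hc₁]; exact_mod_cast chiHi_nonneg w₁
    have hc₂0 : 0 ≤ c₂ := by rw [hc₂]; exact_mod_cast chiHi_nonneg w₂
    have hc21 : c₂ ≤ c₁ := by rw [hc₁, hc₂]; exact_mod_cast hD
    -- the concave minorant
    set β : ℝ := (c₂ - c₁) / (w₂ - w₁) with hβ
    set α : ℝ := c₁ - β * w₁ with hα
    have hβ0 : β ≤ 0 := div_nonpos_of_nonpos_of_nonneg (by linarith) (by linarith)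
    have hαβ2 : α + β * w₂ = c₂ := by
      rw [hα, hβ]; field_simp; ring
    have hconc := concaveOn_lin_mul_LR (α := α) (β := β) h1 h74 hβ0
      (by rw [hαβ2]; exact hc₂0)
    -- barycentric coordinates of `w`
    set lam : ℝ := ((w₂ : ℝ) - w) / (w₂ - w₁) with hlam
    have hlam0 : 0 ≤ lam := div_nonneg (by linarith) (by linarith)
    have hlam1 : lam ≤ 1 := by rw [hlam, div_le_one (by linarith)]; linarith
    have hwcomb : lam * w₁ + (1 - lam) * w₂ = w := by
      rw [hlam]; field_simp; ring
    -- (1) `g w ≥ (α + β w) L w`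
    have hstep1 : (α + β * w) * LR w ≤ gR w := by
      rcases hB.2 with h94 | h94
      · -- below the kink: `c₁ = c₂ = 1`, `g = L`
        have hc1' : c₁ = 1 := by rw [hc₁]; unfold chiHi; rw [if_pos (h12.trans h94)]; push_cast; rfl
        have hc2' : c₂ = 1 := by rw [hc₂]; unfold chiHi; rw [if_pos h94]; push_cast; rfl
        have hβ' : β = 0 := by rw [hβ, hc1', hc2']; simp
        have hα' : α = 1 := by rw [hα, hβ', hc1']; ring
        have h94R : (w₂ : ℝ) ≤ 9 / 4 := by have := castLE h94; push_cast at this; exact this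
        rw [hα', hβ', gR_eq_LR hw0 (hw2.trans h94R)]; ring_nf; rfl
      · -- above the kink: `χ₊ ≤ χ̄` (chord) and `L ≤ 0`
        have h94R : (9 / 4 : ℝ) ≤ w₁ := by have := castLE h94; push_cast at this; exact this
        rw [gR_eq_max_mul (h94R.trans hw1)]
        have hL : LR w ≤ 0 := LR_nonpos (h1.trans hw1)
        refine mul_le_mul_of_nonpos_right ?_ hL
        have hch := max_chord (x := (w₁ : ℝ)) (y := (w₂ : ℝ)) (a := lam) (b := 1 - lam)
          (by linarith) (by linarith) hlam0 (by linarith) (by ring)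
        rw [hwcomb] at hch
        have hx1 := max_le_chiHi h94
        have hx2 := max_le_chiHi (h94.trans h12)
        calc max 0 (4 - 2 * √w)
            ≤ lam * max 0 (4 - 2 * √(w₁ : ℝ)) + (1 - lam) * max 0 (4 - 2 * √(w₂ : ℝ)) := hch
          _ ≤ lam * c₁ + (1 - lam) * c₂ :=
            add_le_add (mul_le_mul_of_nonneg_left hx1 hlam0)
              (mul_le_mul_of_nonneg_left hx2 (by linarith))
          _ = α + β * w := by rw [hα, hβ, hlam]; field_simp; ring
    -- (2) the chord of the concave minorant
    have hstep2 : lam * ((α + β * w₁) * LR w₁) + (1 - lam) * ((α + β * w₂) * LR w₂) ≤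
        (α + β * w) * LR w := by
      have := hconc.2 (x := (w₁ : ℝ)) (y := (w₂ : ℝ)) ⟨le_rfl, h12R⟩ ⟨h12R, le_rfl⟩ hlam0
        (by linarith : (0 : ℝ) ≤ 1 - lam) (by ring)
      simp only [smul_eq_mul] at this
      rw [hwcomb] at this
      exact this
    -- (3) assemble
    have hαβ1 : α + β * w₁ = c₁ := by rw [hα]; ring
    rw [hαβ1, hαβ2] at hstep2
    push_cast
    rw [cast_Lq, cast_Lq]
    have key : (c₂ * LR w₂ - c₁ * LR w₁) / (w₂ - w₁) * w +
        (c₁ * LR w₁ - (c₂ * LR w₂ - c₁ * LR w₁) / (w₂ - w₁) * w₁) =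
        lam * (c₁ * LR w₁) + (1 - lam) * (c₂ * LR w₂) := by
      rw [hlam]; field_simp; ring
    rw [← hc₁, ← hc₂, key]
    exact hstep2.trans hstep1
  · -- fallback
    push_cast; rw [zero_mul, zero_add]; exact neg_le_gR hw0
  · -- `mono`: `g ≥ min (L, 0) ≥ L(w₁)` to the right of `w₁ ≥ 1`
    push_cast
    rw [zero_mul, zero_add, cast_Lq]
    have h1 : (1 : ℝ) ≤ w₁ := by exact_mod_cast hE.1
    have hL1 : LR w₁ ≤ 0 := LR_nonpos h1
    calc LR w₁ = min (LR (w₁ : ℝ)) 0 := (min_eq_left hL1).symm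
      _ ≤ min (LR w) 0 := min_le_min (LR_mono h1 hw1) le_rfl
      _ ≤ gR w := min_LR_zero_le_gR hw0
  · -- fallback
    push_cast; rw [zero_mul, zero_add]; exact neg_le_gR hw0

end Line

/-! ## Soundness of the box checker (part Box) -/

section Box
open Real Set

/-- The summed lines are bilinear in `(u, t)`. [folklore] -/
theorem linesR_eq (ls : List (ℚ × ℚ × ℚ × ℚ × ℚ)) (u t : ℝ) :
    linesR ls u t =
      (ls.map fun l => (l.1 : ℝ) * l.2.2.2.1 * l.2.1).sum * u +
        (ls.map fun l => (l.1 : ℝ) * l.2.2.2.1 * l.2.2.1).sum * (u * t) +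
        (ls.map fun l => (l.1 : ℝ) * l.2.2.2.2).sum := by
  induction ls with
  | nil => simp [linesR]
  | cons l ls ih =>
    simp only [linesR, List.map_cons, List.sum_cons] at ih ⊢
    rw [ih]; ring

/-- Cast of `linesVal`. [folklore] -/
theorem cast_linesVal (ls : List (ℚ × ℚ × ℚ × ℚ × ℚ)) (u t : ℚ) :
    ((linesVal ls u t : ℚ) : ℝ) = linesR ls u t := by
  induction ls with
  | nil => simp [linesVal, linesR]
  | cons l ls ih =>
    simp only [linesVal, linesR, List.map_cons, List.sum_cons] at ih ⊢
    rw [Rat.cast_add, ih]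
    congr 1
    push_cast; ring

/-- An affine function bounded below at the endpoints is bounded below in between. [folklore] -/
theorem affine_ge {p q x₁ x₂ x θ : ℝ} (h1 : x₁ ≤ x) (h2 : x ≤ x₂) (l1 : θ ≤ p + q * x₁)
    (l2 : θ ≤ p + q * x₂) : θ ≤ p + q * x := by
  rcases le_total 0 q with hq | hq
  · nlinarith
  · nlinarith

/-- A bilinear function bounded below at the four corners of a rectangle is bounded below on it.
[folklore] -/
theorem bilinear_ge {A B C u₁ u₂ t₁ t₂ u t θ : ℝ} (hu1 : u₁ ≤ u) (hu2 : u ≤ u₂) (ht1 : t₁ ≤ t)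
    (ht2 : t ≤ t₂) (h11 : θ ≤ A * u₁ + B * (u₁ * t₁) + C) (h12 : θ ≤ A * u₁ + B * (u₁ * t₂) + C)
    (h21 : θ ≤ A * u₂ + B * (u₂ * t₁) + C) (h22 : θ ≤ A * u₂ + B * (u₂ * t₂) + C) :
    θ ≤ A * u + B * (u * t) + C := by
  -- first in `t` at `u = u₁` and `u = u₂`, then in `u`
  have k1 : θ ≤ (A * u₁ + C) + (B * u₁) * t :=
    affine_ge ht1 ht2 (by linarith) (by linarith)
  have k2 : θ ≤ (A * u₂ + C) + (B * u₂) * t :=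
    affine_ge ht1 ht2 (by linarith) (by linarith)
  have k3 : θ ≤ C + (A + B * t) * u :=
    affine_ge hu1 hu2 (by linarith) (by linarith)
  linarith

/-- `FCC` is admissible class data (nonnegative multiplicity and coefficients, `P + K > 0`).
[folklore] -/
theorem admissible_FCC : ∀ c ∈ FCC, 0 ≤ c.1 ∧ 0 ≤ c.2.1 ∧ 0 ≤ c.2.2 ∧ 0 < c.2.1 + c.2.2 := by
  intro c hc
  simp only [FCC, List.mem_cons, List.not_mem_nil, or_false] at hc
  rcases hc with rfl | rfl | rfl | rfl | rfl | rfl | rfl | rfl <;> norm_num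

/-- `HCP` is admissible class data. [folklore] -/
theorem admissible_HCP : ∀ c ∈ HCP, 0 ≤ c.1 ∧ 0 ≤ c.2.1 ∧ 0 ≤ c.2.2 ∧ 0 < c.2.1 + c.2.2 := by
  intro c hc
  simp only [HCP, List.mem_cons, List.not_mem_nil, or_false] at hc
  rcases hc with rfl | rfl | rfl | rfl | rfl | rfl | rfl | rfl <;> norm_num

/-- On the box, the family value dominates the summed lines. [folklore] -/
theorem linesR_le_famR {cls : List (ℚ × ℚ × ℚ)}
    (hcls : ∀ c ∈ cls, 0 ≤ c.1 ∧ 0 ≤ c.2.1 ∧ 0 ≤ c.2.2 ∧ 0 < c.2.1 + c.2.2) {u₁ u₂ t₁ t₂ : ℚ}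
    (hu0 : 0 < u₁) (hu : u₁ ≤ u₂) (ht0 : 0 < t₁) (ht : t₁ ≤ t₂) {u t : ℝ} (hu1 : (u₁ : ℝ) ≤ u)
    (hu2 : u ≤ u₂) (ht1 : (t₁ : ℝ) ≤ t) (ht2 : t ≤ t₂) :
    linesR (boxLines cls u₁ u₂ t₁ t₂) u t ≤ famR cls u t := by
  induction cls with
  | nil => simp [linesR, famR, boxLines]
  | cons c cls ih =>
    have hc := hcls c (by simp)
    have ih' := ih fun c' hc' => hcls c' (by simp [hc'])
    simp only [linesR, famR, boxLines, List.map_cons, List.sum_cons] at ih' ⊢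
    refine add_le_add ?_ ih'
    obtain ⟨hm, hP, hK, hPK⟩ := hc
    -- the `w`-range of the class on the box
    have hPK1 : 0 < c.2.1 + c.2.2 * t₁ := by
      rcases eq_or_lt_of_le hK with hK0 | hKpos
      · rw [← hK0] at hPK ⊢; simpa using hPK
      · have := mul_pos hKpos ht0; linarith
    have hw0 : 0 < u₁ * (c.2.1 + c.2.2 * t₁) := mul_pos hu0 hPK1
    have hw12 : u₁ * (c.2.1 + c.2.2 * t₁) ≤ u₂ * (c.2.1 + c.2.2 * t₂) :=
      mul_le_mul hu (by nlinarith) hPK1.le (by linarith)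
    have hlo : ((u₁ * (c.2.1 + c.2.2 * t₁) : ℚ) : ℝ) ≤ u * (c.2.1 + c.2.2 * t) := by
      push_cast
      have hPKR : (0 : ℝ) ≤ (c.2.1 : ℝ) + c.2.2 * t₁ := by exact_mod_cast hPK1.le
      have hKR : (0 : ℝ) ≤ c.2.2 := by exact_mod_cast hK
      have hu0R : (0 : ℝ) ≤ u₁ := by exact_mod_cast hu0.le
      exact mul_le_mul hu1 (by nlinarith) hPKR (by linarith)
    have hhi : u * (c.2.1 + c.2.2 * t) ≤ ((u₂ * (c.2.1 + c.2.2 * t₂) : ℚ) : ℝ) := by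
      push_cast
      have hKR : (0 : ℝ) ≤ c.2.2 := by exact_mod_cast hK
      have hPR : (0 : ℝ) ≤ c.2.1 := by exact_mod_cast hP
      have hu0R : (0 : ℝ) ≤ u := le_trans (by exact_mod_cast hu0.le) hu1
      have ht0R : (0 : ℝ) ≤ t := le_trans (by exact_mod_cast ht0.le) ht1
      exact mul_le_mul hu2 (by nlinarith) (by nlinarith) (by linarith)
    have hline := lineLB_sound hw0 hw12 hlo hhi
    have hmR : (0 : ℝ) ≤ c.1 := by exact_mod_cast hm
    have := mul_le_mul_of_nonneg_left hline hmR
    linarith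

/-- **Soundness of `famOK`.** [folklore] -/
theorem famOK_sound {cls : List (ℚ × ℚ × ℚ)}
    (hcls : ∀ c ∈ cls, 0 ≤ c.1 ∧ 0 ≤ c.2.1 ∧ 0 ≤ c.2.2 ∧ 0 < c.2.1 + c.2.2) {u₁ u₂ t₁ t₂ : ℚ}
    (hok : famOK cls u₁ u₂ t₁ t₂ = true) (hu0 : 0 < u₁) (hu : u₁ ≤ u₂) (ht0 : 0 < t₁)
    (ht : t₁ ≤ t₂) {u t : ℝ} (hu1 : (u₁ : ℝ) ≤ u) (hu2 : u ≤ u₂) (ht1 : (t₁ : ℝ) ≤ t)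
    (ht2 : t ≤ t₂) : (THR : ℝ) ≤ famR cls u t := by
  refine le_trans ?_ (linesR_le_famR hcls hu0 hu ht0 ht hu1 hu2 ht1 ht2)
  set ls := boxLines cls u₁ u₂ t₁ t₂ with hls
  simp only [famOK, Bool.and_eq_true, decide_eq_true_eq] at hok
  rw [← hls] at hok
  obtain ⟨⟨⟨h11, h12⟩, h21⟩, h22⟩ := hok
  have c11 := castLE h11; have c12 := castLE h12; have c21 := castLE h21; have c22 := castLE h22
  rw [cast_linesVal, linesR_eq] at c11 c12 c21 c22
  rw [linesR_eq]
  exact bilinear_ge hu1 hu2 ht1 ht2 c11 c12 c21 c22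

/-- **Soundness of `boxOK`.** [folklore] -/
theorem boxOK_sound {u₁ u₂ t₁ t₂ : ℚ} (hok : boxOK u₁ u₂ t₁ t₂ = true) (hu0 : 0 < u₁)
    (hu : u₁ ≤ u₂) (ht0 : 0 < t₁) (ht : t₁ ≤ t₂) {u t : ℝ} (hu1 : (u₁ : ℝ) ≤ u) (hu2 : u ≤ u₂)
    (ht1 : (t₁ : ℝ) ≤ t) (ht2 : t ≤ t₂) :
    (THR : ℝ) ≤ famR FCC u t ∧ (THR : ℝ) ≤ famR HCP u t := by
  simp only [boxOK, Bool.and_eq_true] at hok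
  exact ⟨famOK_sound admissible_FCC hok.1 hu0 hu ht0 ht hu1 hu2 ht1 ht2,
    famOK_sound admissible_HCP hok.2 hu0 hu ht0 ht hu1 hu2 ht1 ht2⟩

/-- **Soundness of the bisection `check`.** [folklore] -/
theorem check_sound : ∀ (f : ℕ) {u₁ u₂ t₁ t₂ : ℚ}, check f u₁ u₂ t₁ t₂ = true → 0 < u₁ → u₁ ≤ u₂ →
    0 < t₁ → t₁ ≤ t₂ → ∀ {u t : ℝ}, (u₁ : ℝ) ≤ u → u ≤ u₂ → (t₁ : ℝ) ≤ t → t ≤ t₂ →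
    (THR : ℝ) ≤ famR FCC u t ∧ (THR : ℝ) ≤ famR HCP u t
  | 0, u₁, u₂, t₁, t₂, hc, hu0, hu, ht0, ht, u, t, hu1, hu2, ht1, ht2 => by
    simp only [check] at hc
    exact boxOK_sound hc hu0 hu ht0 ht hu1 hu2 ht1 ht2
  | f + 1, u₁, u₂, t₁, t₂, hc, hu0, hu, ht0, ht, u, t, hu1, hu2, ht1, ht2 => by
    simp only [check, Bool.or_eq_true, Bool.and_eq_true] at hc
    rcases hc with hc | ⟨⟨⟨h1, h2⟩, h3⟩, h4⟩
    · exact boxOK_sound hc hu0 hu ht0 ht hu1 hu2 ht1 ht2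
    · have hum1 : u₁ ≤ (u₁ + u₂) / 2 := by linarith
      have hum2 : (u₁ + u₂) / 2 ≤ u₂ := by linarith
      have htm1 : t₁ ≤ (t₁ + t₂) / 2 := by linarith
      have htm2 : (t₁ + t₂) / 2 ≤ t₂ := by linarith
      have hum0 : 0 < (u₁ + u₂) / 2 := by linarith
      have htm0 : 0 < (t₁ + t₂) / 2 := by linarith
      have cum : (((u₁ + u₂) / 2 : ℚ) : ℝ) = ((u₁ : ℝ) + u₂) / 2 := by push_cast; ring
      have ctm : (((t₁ + t₂) / 2 : ℚ) : ℝ) = ((t₁ : ℝ) + t₂) / 2 := by push_cast; ring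
      rcases le_total u (((u₁ : ℝ) + u₂) / 2) with hum | hum <;>
        rcases le_total t (((t₁ : ℝ) + t₂) / 2) with htm | htm
      · exact check_sound f h1 hu0 hum1 ht0 htm1 hu1 (by rw [cum]; exact hum) ht1 (by rw [ctm]; exact htm)
      · exact check_sound f h2 hu0 hum1 htm0 htm2 hu1 (by rw [cum]; exact hum) (by rw [ctm]; exact htm) ht2
      · exact check_sound f h3 hum0 hum2 ht0 htm1 (by rw [cum]; exact hum) hu2 ht1 (by rw [ctm]; exact htm)
      · exact check_sound f h4 hum0 hum2 htm0 htm2 (by rw [cum]; exact hum) hu2 (by rw [ctm]; exact htm) ht2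

/-- **Soundness of the certificate**: the reference bound and the two strips. [folklore] -/
theorem certificate_sound (hc : certificate = true) :
    (refHi : ℝ) + 1 / 20000 ≤ THR ∧
    (∀ {u t : ℝ}, 8649 / 10000 ≤ u → u ≤ 10404 / 10000 → 6084 / 10000 ≤ t → t ≤ 652864 / 1000000 →
      (THR : ℝ) ≤ famR FCC u t ∧ (THR : ℝ) ≤ famR HCP u t) ∧
    (∀ {u t : ℝ}, 8649 / 10000 ≤ u → u ≤ 10404 / 10000 → 680625 / 1000000 ≤ t → t ≤ 7396 / 10000 →
      (THR : ℝ) ≤ famR FCC u t ∧ (THR : ℝ) ≤ famR HCP u t) := by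
  simp only [certificate, Bool.and_eq_true, decide_eq_true_eq] at hc
  obtain ⟨⟨h0, h1⟩, h2⟩ := hc
  refine ⟨?_, ?_, ?_⟩
  · have := castLE h0; push_cast at this; exact this
  · intro u t hu1 hu2 ht1 ht2
    exact check_sound 9 h1 (by norm_num) (by norm_num) (by norm_num) (by norm_num)
      (by push_cast; linarith) (by push_cast; linarith) (by push_cast; linarith) (by push_cast; linarith)
  · intro u t hu1 hu2 ht1 ht2
    exact check_sound 9 h2 (by norm_num) (by norm_num) (by norm_num) (by norm_num)
      (by push_cast; linarith) (by push_cast; linarith) (by push_cast; linarith) (by push_cast; linarith)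

end Box

/-- **Registered sub-goal `strainedMargin_certificate_sound`** (summary of this file): if the
certificate evaluates to `true` then the reference bound holds and both families are `≥ THR` on
the two strained strips. [folklore] -/
theorem strainedMargin_certificate_sound : certificate = true → ((refHi : ℝ) + 1 / 20000 ≤ THR) ∧ (∀ u t : ℝ, 8649 / 10000 ≤ u → u ≤ 10404 / 10000 → 6084 / 10000 ≤ t → t ≤ 652864 / 1000000 → (THR : ℝ) ≤ famR FCC u t ∧ (THR : ℝ) ≤ famR HCP u t) ∧ (∀ u t : ℝ, 8649 / 10000 ≤ u → u ≤ 10404 / 10000 → 680625 / 1000000 ≤ t → t ≤ 7396 / 10000 → (THR : ℝ) ≤ famR FCC u t ∧ (THR : ℝ) ≤ famR HCP u t) :=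
  fun hc => ⟨(certificate_sound hc).1, fun _ _ hu1 hu2 ht1 ht2 => (certificate_sound hc).2.1 hu1 hu2 ht1 ht2,
    fun _ _ hu1 hu2 ht1 ht2 => (certificate_sound hc).2.2 hu1 hu2 ht1 ht2⟩

end Summit.AtomisticToContinuum.Crystallization.Theorems.PricedLinkCensusTruncatedCensusGap.StrainedMargin
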